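import Mathlib
import Literature.AlgebraicGeometry.Resolution.LocalBlowup
import Literature.AlgebraicGeometry.Resolution.ExcellentRings
import HarnessLib

/-!
# Cossart–Piltant 2019, Theorem 1.5 (i) with Proposition 2.22 — base-side tower («frame») form

**ERRATUM (revision 2, 2026-08-28; docstrings only, the declaration is byte-identical to revision 1 / p660730).
`CossartPiltant2019_thm_1_5_i_frame` is FALSE AS TYPED: it is an OVER-READ of Cossart–Piltant 2019, Thm 1.5 (i) with
Prop 2.22, not a rendering of it.  It must never be taken as a live hypothesis; every theorem carrying
`(hF : CossartPiltant2019_thm_1_5_i_frame)` is sound but VACUOUS.  Do NOT attempt `_holds`; the negation is the target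
(`Summit.ResolutionOfSingularities.ResolutionOfSingularities.Cruxes.DescentPerfectToAll.NegationLens6g3.F110False`,
kernel-certified `↔ FrameFailsAtDim 3`).  Rulings of record: critic res-B-crit-1, `B/res-B-crit-1/VERDICT-F110-challenge.md`
(sha16 4f8c22baff37bd88, ruling (β) CONFIRMED) and critic res-inputs-crit-1 R190, on the challenge of res-B-lens-6 g3
(`Cruxes/DescentPerfectToAll/NEGATION-lens6-g3.md` + `NegationLens6g3.lean`, 0 sorry).  Details in the ERRATUM section
of the declaration's docstring below; the rest of this header and of that docstring is kept as filed for the record and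
must be read through the erratum.**

Topic `Literature/AlgebraicGeometry/CossartPiltant200819`.  ONE named ~~fact~~ statement (lean/CONVENTIONS.md §4;
consumers took `(hF : CossartPiltant2019_thm_1_5_i_frame)`; by the ERRATUM there is nothing to discharge:
`theorem CossartPiltant2019_thm_1_5_i_frame_holds` is unprovable, and `¬ CossartPiltant2019_thm_1_5_i_frame.{0}` is
proved on paper — see below).

Source (published, refereed): V. Cossart, O. Piltant, *Resolution of singularities of arithmetical threefolds*,
J. Algebra **529** (2019) 268–535 [CossartPiltant2019]: Theorem 1.5 (pp. 271–272), case (i) (the purely inseparable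
case `h = X^p + f_p`), together with Definitions 2.20/2.21 («Hironaka-permissible centre», p. 293), the notion of a
*local* Hironaka-permissible blowing up (p. 294) and Proposition 2.22 (p. 294) with the chart formula (2.18) of its proof
(p. 295).  arXiv twin: arXiv:1412.0868v1, Theorem 1.4 (= journal Thm 1.5) and Proposition 2.7.

Design.  The body of `CossartPiltant2019_thm_1_5_i_frame` is, VERBATIM, the statement of the registered consumer stub
`stub_cp2019Thm15iFrame` of the crux skeleton
`Summits/ResolutionOfSingularities/ResolutionOfSingularities/Cruxes/CleanModels/Lines/Sketch.lean` (rev 12 / 13.1, namespace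
`Summit.ResolutionOfSingularities.ResolutionOfSingularities.Theorems.RadicialJung.CleanModels`), with the two carrier types
`S`, `K` generalised from `Type` to `Type u`; at `u = 0` the definition is syntactically that statement (certified by `rfl`
against the stub before filing).  Vocabulary: `Literature.AlgebraicGeometry.Resolution.locAtCentre` and
`….IsLocalBlowupAlong` (`Resolution/LocalBlowup.lean`), `….IsExcellentRing` (`Resolution/ExcellentRings.lean`), Mathlib's
`ValuationSubring`, `IsRegularLocalRing`, `ringKrullDim`, `AdjoinRoot`.  The statement is BASE-SIDE: it speaks about a tower of
regular local subrings `B i` of `K = Frac S` below the valuation ring `O`, and about the radicands `g i ∈ B i` of the strict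
transforms `X^p - g i` of `h = X^p - f`, never about the schemes `𝒳_i` themselves; the last clause identifies the germ
`(𝒳_n, x_n)` with `Spec (B n)[X]/(X^p - g n)` (Prop. 2.22 at the last stage; this ring is local, `X^p - ḡ` having a
single prime factor over the residue field).

Related tree declarations (cross-referenced, deliberately not imported):
`Literature.AlgebraicGeometry.Resolution.CossartPiltant2019Local` (`Resolution/ArithmeticalThreefoldsLocal.lean`) is another
typed reading of the SAME printed theorem — cover-side, weak local uniformization over `L` with data `(L, x, t)`, cases (i) ∨ (ii),
no tower and no `K^p`-line bookkeeping; the present base-side frame (case (i) only) implies case (i) of it in substance.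
Two readings of one theorem for two different consumers; the converse direction must never be filed as a fact.
`Literature.AlgebraicGeometry.CossartPiltant200819.Skeleton2019.Setting.LocalUniformization` is the schematic node over an
abstract setting; `Literature.AlgebraicGeometry.Resolution.CossartPiltant2019LU3` is the variety-level local uniformization.

What is deliberately NOT here: no proof; no condition (E) (Def. 2.32) and no permissibility *with respect to* `E` (the frame
takes `E = ∅`); the multiplicity clause `m(y) = m(x)` of Def. 2.20 is not asserted of the centres (only their regularity,
as `IsRegularLocalRing (B i ⧸ P)`); the independence of the blowing-up sequence from the valuation `μ`, the invariants
`(m, ω, κ)` and their behaviour, and the specific chart values `(c, d) = (u⁻¹, -θ/u)` of (2.18) are not asserted (the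
statement only asks for SOME `c ≠ 0`, `d` with `g (i+1) = c^p * g i + d^p`).  Each of these omissions WEAKENS the printed
conclusion or drops an unused hypothesis-free refinement; none strengthens it.

**Caveat: this types a printed theorem as a `Prop`; it proves nothing.  AI reading is weaker than expert review —
and here the reading WAS wrong: see the ERRATUM (the END clause of READING (d) is stronger than print and false).**
-/

open Literature.AlgebraicGeometry.Resolution

namespace Literature.AlgebraicGeometry.CossartPiltant200819

universe u

/-- **ERRATUM (revision 2, 2026-08-28) — THIS STATEMENT IS FALSE AS TYPED.  It is NOT a named fact: do not take
`(hF : CossartPiltant2019_thm_1_5_i_frame)` as a live hypothesis (consumers doing so are sound but vacuous), do not try to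
prove `_holds`.**  INPUTS row F-110 «F-CP15-frame» stays in the tree byte-identical (importers:
`Cruxes/CleanModels/Lines/Sketch.lean` stub `stub_cp2019Thm15iFrame`, `Cruxes/DescentPerfectToAll/NegationLens6g3.lean`,
p659057 / p659322 / p660825) so that its NEGATION can be stated against it:
`NegationLens6g3.F110False := ¬ CossartPiltant2019_thm_1_5_i_frame.{0}` (`↔ FrameFailsAtDim 3`, kernel-checked).

WHY FALSE — witness (critic-verified twice, independently): `p = 5`, `k = 𝔽₅`, `S = k[x,y,w]_{(x,y,w)}` (excellent regular
local, `dim 3`, `char 5`), `K = k(x,y,w)`, `f = x²y` (not a 5th power), `O = O_ν` for `ν = μ₁ ∘ μ₂`, `μ₁` the monomial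
valuation of `k(w)(x,y)` with `μ₁(x) = 1`, `μ₁(y) = φ = (1+√5)/2` (trivial on `k(w)`), `μ₂` the `w`-adic valuation of `k(w)`
(«golden valuation»; `O ⊇ S` dominating, `κ(O) = k`).  Every hypothesis above holds, and for EVERY tower the statement could
produce, the END clause fails: for every regular local `B` with `S ⊆ B ⊆ O` dominated by `O` and essentially of finite type
over `k`, and every `g = c⁵x²y + d⁵ ∈ B` (`c ∈ Kˣ`, `d ∈ K`), `B[X]/(X⁵ - g)` is NOT regular.  Proof sketch (paper-rigorous,
`NEGATION-lens6-g3.md` §1 steps A–E = `VERDICT-F110-challenge.md` §3 (a)–(d)): localise `B` at the centre `𝔮` of `μ₁`;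
`G := B_𝔮` is a 2-dimensional regular local ring of `k(w)(x,y)` dominated by `μ₁`, hence (ABHYANKAR 1956, Amer. J. Math. 78,
Thm 3: factorisation of a birational domination of 2-dimensional regular local rings into quadratic transforms) an iterated
quadratic transform `T_j = k(w)[X_j,Y_j]_{(X_j,Y_j)}` of `k(w)[x,y]_{(x,y)}` along `μ₁` — the golden chain, in which
`x²y = X_j^{m_j} Y_j^{n_j}` with `(m_j,n_j) ≡ (2,1),(3,1),(3,4),(2,4) (mod 5)` of period 4, both exponents prime to 5 and
`m̄_j + n̄_j ≥ 3` (equivalently: the character `χ(m + nφ) = m - 2n (mod 5)` kills every value of `K⁵(x²y) ∖ K⁵` and no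
value of a regular parameter of `T_j` — `5` divides no Lucas number; `chi_lineValue`, `chi_gold_ne_zero` in
`NegationLens6g3.lean`); the `p`-basis decomposition `G = ⊕ G⁵·w^k X^a Y^b` then forces `g = a⁵ + b⁵X^{m̄}Y^{n̄}` with
`a, b ∈ G`, so `g - a⁵ ∈ 𝔪_G³ ⊆ 𝔪_G²`, and a radicand congruent to a 5th power modulo `𝔪²` never gives a regular
`G[X]/(X⁵ - g)` (embedding dimension `dim + 1`); regularity localises, so `B[X]/(X⁵ - g)` is not regular either.

WHY THE READING OVER-REACHED (by page, J. Algebra 529): Thm 1.5 (pp. 271–272) blows up the COVER `𝒳 = Spec S[X]/(h)` and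
ends with `(𝒳_r, x_r)` regular — no base-side tower, no radicands, no degree-`p` endpoint; Prop 2.22 (p. 294) keeps the shape
`S′[X′]/(h′)`, `h′` monic of degree `m`, only under blowing ups that are Hironaka-permissible, i.e. with centre inside
`Sing_m 𝒳` (`m(y) = m(x) = m`, Def 2.20/2.21 pp. 293–294); and Cor 5.6 (p. 405) VERBATIM: «Theorem 1.5 is then an immediate
consequence of [31] Main Theorem 1.3 (m(x) < p), Theorem 2.81 ((m(x), ω(x)) = (p, 0)) and Theorem 5.5» — every point of
multiplicity `< p` (in particular the last steps before the regular endpoint, and the witness from the start: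
`ord (Z⁵ - x²y) = 3 < 5`) is handled by Cossart–Piltant 2014 OUTSIDE the degree-`p` frame.  So READING (d) below («by
Prop. 2.22 at the last stage `𝒳_n ×_{𝒮_n} Spec (B n) = Spec (B n)[X]/(X^p - g n)`») is an over-read: the END clause is
STRONGER than print.  The kept clauses (a)–(c) are weaker than print, as the pre-audit said; the error is (d) alone.
The print-faithful reading of the same theorem is the cover-side weak local uniformization
`Literature.AlgebraicGeometry.Resolution.CossartPiltant2019Local` — re-point consumers there.  A print-faithful base-side
variant («frame UNTIL the multiplicity drops»: END replaced by «`AdjoinRoot (X^p - g n)` regular ∨ the multiplicity of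
`X^p - g n` at the closed point of `B n` is `< p`», Prop 2.22 + Thm 2.81 + Thm 5.5) is NOT filed here and must be cleared
with the critic before anyone types it.

RULINGS OF RECORD: res-B-crit-1, `run/shared/lean/pub/res-hironaka/B/res-B-crit-1/VERDICT-F110-challenge.md`
(sha16 4f8c22baff37bd88): «(β) CONFIRMED — F-110 is FALSE AS TYPED. It must never go LIVE as typed; consumers are vacuous,
not unsound»; res-inputs-crit-1 R190 (same ruling, INPUTS side); challenger res-B-lens-6 g3 (`NEGATION-lens6-g3.md`,
`NegationLens6g3.lean`, crux idea `golden-line-character-vs-regular-frame`, graded VALID OBSTRUCTION / utility HIGH).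
Lean status of the negation: `¬ CossartPiltant2019_thm_1_5_i_frame.{0}` is proved MODULO the construction of the golden
witness (negative lemma under `Summits/ResolutionOfSingularities/ResolutionOfSingularities/Theorems/CleanModels/Negative/`,
INPUTS seat res-inputs-p-cp15frame g1); the unconditional refutation waits for the composite valuation as a
`ValuationSubring` and Abhyankar's factorisation theorem (to be typed as a Literature fact).  What follows is the
revision-1 docstring, kept for the record; read every «NAMED FACT» / «PROVED theorem» in it through this erratum.

(Revision 1 text.)  INPUTS row F-110 «F-CP15-frame» — **Cossart–Piltant 2019, Theorem 1.5 (i) with Proposition 2.22,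
in base-side tower («frame») form** — AS THEN READ; the reading is withdrawn above.

PRINT.  Thm 1.5 (J. Algebra 529, p. 271 l. 37 – p. 272 l. 9): «Let `(S, m_S, k)` be an excellent regular local ring of
dimension `n = 3`, quotient field `K := QF(S)` and residue characteristic `char k = p > 0`. Let
`h := X^p + f₁X^{p-1} + ⋯ + f_p ∈ S[X]` (1.1) be a reduced polynomial, `𝒳 := Spec(S[X]/(h))` and `L := Tot(S[X]/(h))` …
Assume … (i) `char K = p` and `f₁ = ⋯ = f_{p-1} = 0` … Let `μ` be a valuation of `L` which is centered in `m_S`. There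
exists a composition of local Hironaka-permissible blowing ups `(𝒳 =: 𝒳₀, x₀) ← (𝒳₁, x₁) ← ⋯ ← (𝒳_r, x_r)` (1.2), where
`x_i ∈ 𝒳_i` is the center of `μ`, such that `(𝒳_r, x_r)` is regular.»  Def. 2.20/2.21 (p. 293 l. 37 – p. 294 l. 5):
a Hironaka-permissible centre `𝒴 ∋ x` has `m(y) = m(x)` and `𝒴` regular at `x`; w.r.t. `E`: moreover `W := η(𝒴)` has
normal crossings with `E`, i.e. `I(W) = ({u_j}_{j ∈ J})` for part of a r.s.p. of `S`.  p. 294 l. 12–14: «By a local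
Hironaka-permissible blowing up, we simply mean the localization at some point of the exceptional divisor `π⁻¹(𝒴)` of
the blowing up `π` along a Hironaka-permissible center.»  Prop. 2.22 (p. 294 l. 16–35): for `π : 𝒳′ → 𝒳` a
Hironaka-permissible blowing up w.r.t. `E` at `x` there is a commutative square (2.17) over `σ : 𝒮′ → Spec S`, the
blowing up along `W`, and «For every `s′ ∈ σ⁻¹(s)`, `S′ := 𝒪_{𝒮′,s′}`, there exists `h′ ∈ S′[X′]` monic of degree `m`
such that `𝒳′_{s′} = Spec(S′[X′]/(h′))`»; its proof (p. 294 l. 36 – p. 295 l. 8): `I(𝒴) = (Z, {u_j}_{j ∈ J})` with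
`Z := X - θ`, `θ ∈ S`, chart `X′ := Z/u_{j₀}` and `h′ := u_{j₀}^{-m} h(Z)` (2.18).  In case (i), writing OUR sign
convention `h = X^p - g` (printed `X^p + f_p`, `g := -f_p`): `h = (Z + θ)^p - g = Z^p - (g - θ^p)`, hence
`h′ = X′^p - (g - θ^p)/u^p`, i.e. the new radicand is `g′ = c^p·g + d^p` with `c = 1/u ≠ 0`, `d = -θ/u`.
arXiv twin: arXiv:1412.0868v1 p. 4 l. 12–33, Theorem 1.4 (= journal Thm 1.5); Prop. 2.7 there = journal Prop. 2.22.
[corpus: paper:cossart2019-resolution-singularities-arithmetical-threefolds p0004 L37–p0005 L9; p0026 L36–p0027 L14;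
p0027 L15–47; p0028 L1–8] [corpus: paper:arxiv-1412.0868 p0004 L12–33]

READING (composite rendering, one routine step per link).  (a) `L = K(g^{1/p})` is purely inseparable over `K`
(`h = X^p - g` reduced ⟺ `g ∉ K^p`, typed `∀ c : K, c ^ p ≠ f`), so valuations `μ` of `L` centred in `m_S` correspond
uniquely to valuation rings `O` of `K` dominating `S` (typed: `range (S → K) ≤ O` and every `s ∈ m_S` has
`O.valuation s < 1`).  (b) The base-side tower `S = B 0 ≤ B 1 ≤ ⋯ ≤ B n ≤ O` (`B 0 = locAtCentre S O = S`, `S` being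
local with centre `m_S`): `B (i+1) = 𝒪_{𝒮_{i+1}, s_{i+1}}` is the local blowing up of `B i` along `P_i = I(W_i)` with
respect to `O` — `IsLocalBlowupAlong O (B i) P (B (i+1))` localises the chart of a generator of MINIMAL `O`-value at the
centre of `O`, which is exactly the point `s_{i+1}` under the centre `x_{i+1}` of `μ`; `W_i` regular is
`IsRegularLocalRing (B i ⧸ P)`; every `B i` is regular local (blowing up of a regular local ring along a regular centre,
localised) and `g i ∈ B i`.  (c) `g i` is the radicand of the strict transform `h_i = X^p - g i` (`g 0 = f`), and (2.18)
in case (i) gives `g (i+1) = c^p * g i + d^p` with `c ≠ 0` — the `K^p`-LINE bookkeeping the consumer needs.  (d) END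
[ERRATUM: THIS STEP IS THE OVER-READ — Prop. 2.22 is NOT available at the last stage, where `m(x_n) = 1 < p`; see the
erratum above and Cor 5.6 p. 405]: `(𝒳_n, x_n)` regular; by Prop. 2.22 at the last stage
`𝒳_n ×_{𝒮_n} Spec (B n) = Spec (B n)[X]/(X^p - g n)`, a LOCAL ring (radicial over the local ring `B n`), so
«`(𝒳_n, x_n)` is regular» reads `IsRegularLocalRing (AdjoinRoot (X^p - C (g n)))`; the binder `hg : g n ∈ B n` only
packages `g n` as an element of `B n`.

NOT ASSERTED (each omission weakens the printed conclusion, none strengthens it [ERRATUM: true of these omissions; the END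
clause (d), however, STRENGTHENS print and is false]): condition (E) and permissibility with
respect to `E` (here `E = ∅`); the clause `m(y) = m(x)` of Def. 2.20; independence of the sequence from `μ`; the
invariants `(m, ω, κ)`; the specific values `(c, d) = (u⁻¹, -θ/u)` (only `∃ c ≠ 0, d`).  Case (ii) of Thm 1.5 (the
`ℤ/p`-Galois case) is not typed here.  Cross-reference: `Literature.AlgebraicGeometry.Resolution.CossartPiltant2019Local`
is the cover-side weak-uniformization reading of the same theorem (cases (i) ∨ (ii)); do not file either direction between
the two readings as a fact.

SHAPE.  Universe-polymorphic in `u` (`S K : Type u`); the registered consumer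
`Summit.ResolutionOfSingularities.ResolutionOfSingularities.Theorems.RadicialJung.CleanModels.stub_cp2019Thm15iFrame`
(`Cruxes/CleanModels/Lines/Sketch.lean`) is this definition at `u = 0`, verbatim.  [ERRATUM: NOT «a PROVED, refereed
theorem typed as a `Prop`» — a FALSE over-reading of one; the printed theorem (Thm 1.5 (i)) is fine and is
`CossartPiltant2019Local`; this `Prop` is kept only as the target of its negation.]
[cite: CossartPiltant2019, Thm. 1.5 (i), Prop. 2.22, Cor. 5.6] -/
def CossartPiltant2019_thm_1_5_i_frame : Prop :=
  ∀ (p : ℕ), p.Prime →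
    ∀ (S : Type u) [CommRing S] [IsRegularLocalRing S],
      IsExcellentRing S → ringKrullDim S = 3 → CharP S p →
    ∀ (K : Type u) [Field K] [Algebra S K] [IsFractionRing S K] (f : S),
      (∀ c : K, c ^ p ≠ algebraMap S K f) →
    ∀ (O : ValuationSubring K), (algebraMap S K).range ≤ O.toSubring →
      (∀ s ∈ IsLocalRing.maximalIdeal S, O.valuation (algebraMap S K s) < 1) →
    ∃ (n : ℕ) (B : ℕ → Subring K) (g : ℕ → K),
      B 0 = locAtCentre (algebraMap S K).range O ∧ g 0 = algebraMap S K f ∧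
      (∀ i ≤ n, B i ≤ O.toSubring ∧ IsRegularLocalRing (B i) ∧ g i ∈ B i) ∧
      (∀ i < n, ∃ P : Ideal (B i), IsRegularLocalRing ((B i) ⧸ P) ∧
        IsLocalBlowupAlong O (B i) P (B (i + 1)) ∧
        ∃ c d : K, c ≠ 0 ∧ g (i + 1) = c ^ p * g i + d ^ p) ∧
      ∀ hg : g n ∈ B n, IsRegularLocalRing (AdjoinRoot (Polynomial.X ^ p - Polynomial.C (⟨g n, hg⟩ : B n)))

end Literature.AlgebraicGeometry.CossartPiltant200819
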